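/-
Copyright (c) 2026 the pub-hodgecm-mathlib formalisation cell (harness21).  Prover seat hodgecm-mathlib-F0P2-p10 (g3), Track B «K2-LIT»,
#184♮ = hLiu418 = `stmt-HodgeConjecture-24832`; FACE-D₀ (B1c′) chain of K2Liu-p02 (g9), FILE 2 (LEAD F0P6-plan (g15) BATCH #183 (1), 2026-09-05T00:25:41Z), part `K2LiuLinePairCayleySiegelModel`.
THEOREMS ONLY (no `def`, no `instance`, no notation, no named-fact hypothesis, no `sorry`).
-/
import Summits.HodgeConjecture.HodgeConjecture.Theorems.K2LiuLinePairCayleySiegel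
import HarnessLib

/-!
# Crux `HLiu418`, FACE-D₀ (B1c′), FILE 2 — `K2LiuLinePairCayleySiegel`: THE SIEGEL PARABOLIC `P_Δ(𝔸)` OF THE DOUBLED UNITARY GROUP INSIDE THE
# LINE PAIR `(U(𝔻), U(⟨a′⟩))`, IN THE `κ′`-MODEL — FILE 2b (§4): the `κ′`-MODEL of `P_Δ(𝔸)` in the line pair
# (§0–§3 = FILE 2a `K2LiuLinePairCayleySiegel`, §5 = FILE 2c `…Unipotent`; the 400-line cut)

Cell `hodgecm-mathlib`, crux item hLiu418 = `stmt-HodgeConjecture-24832` (helper lane `--supports … --as helper`, count-neutral), route of record `HCCMUnconditional`;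
squad K2 ∕ K2Liu, road `K2_Liu`, socket #42F′ FACE-D₀ `h2₂`, chain (B1c′-1) FILE 1 `K2LiuMetaplecticUnipotentRigidity` (K2Liu-p02) → FILE 2 (this) → FILE 3
`K2LiuLinePairKappaModelOnUnipotents` (K2Liu-p02), (B1c′-2b) `K2LiuFinChirpLocalGramReading` (K2E3-p23).

THE SETTING.  `H = U(𝔻)`, `𝔻 = 𝕍 ⊕ (−𝕍)` the doubled hermitian space of the datum `(e, dV, dW)` (★ `DoubledUnitaryGlobalSplittingData`: `HA`, `blk`, `IsSiegelDelta`,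
`toSpD = ι^𝔻`, `gramDA = T^𝔻 ⊗ 1`).  The FACE pairs `H` with the hermitian LINE `⟨a′⟩` (`a′ ∈ (L⁺)ˣ`, ★ Liu2021 `TW a′`): the big symplectic space is `Res(𝔻 ⊗ ⟨a′⟩)` with Gram
`T₁ := adelicGram e₁ (diag dD) (a′) = reindex e₁ e₁ ((diag dD ⊗ 1) ⊗ₖ (a′))` along an enumeration `e₁ : Fin (n+n) × Fin 1 ≃ Fin n″`, and `h ∈ H(𝔸)` acts through
`j(h) := toSp (adelicInl (toDiagA h)) ∈ Sp(𝕎₁)` (★ `UnitaryDualPairSplittingDatum.toSp = spReindex e₁ ∘ adelicPairToSymplectic`, ★ `toDiagA : H(𝔸) ≃* U(diag dD)(𝔸)` the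
identity on matrices).  Write `U h := untransportSp T^𝔻 (ι^𝔻 h)` (★ (K-b): the block matrix `(re h, d • im h (T^𝔻)⁻¹; T^𝔻 im h, T^𝔻 re h (T^𝔻)⁻¹)`), `κ_n := reindex σ σ κ`
(`σ = e₂ ⊕ e₂`, ★ `K2LiuCayleyMoverFin`), `D_c := (1, 0; 0, c • 1)`, `e₁′ := prodUnique⁻¹ ≫ e₁ : Fin (n+n) ≃ Fin n″`, `ρ := e₁′ ⊕ e₁′`.
* §0 block algebra over a commutative ring: `D_c · (P, Q; R, S) · D_{c′} = (P, c′ • Q; c • R, S)` (`c c′ = 1`); **`diag_conj_mem_symplecticGroup`** — `D_c X D_{c′} ∈ Sp` for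
  `X ∈ Sp` (`D_{c′} J D_{c′}ᵀ = c′ • J`: a similitude conjugation); reindexing along `ε ⊕ ε`.
* §1 plumbing: **`untransportSp_spReindex`** (`untransportSp (reindex T) (spReindex e g) = spMatrixReindex e (untransportSp T g)`, from ★ `spReindex_transportSp`);
  **`coe_untransportSp_adelicPairToSymplectic`** — ★ (K-b) for a PAIR datum: the standard-Darboux matrix of `adelicPairToSymplectic x`, `x ∈ G₁(𝔸) ≤ GL_{N×M}(𝔸_L)`, is
  `(re x, d • im x T⁻¹; T im x, T re x T⁻¹)` at `T = T_V ⊗ₖ T_W` (★ (K-a) `darboux_resAut_darboux_symm` verbatim); the kronecker-with-`Fin 1` bookkeeping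
  (`x ⊗ₖ 1 = reindex p⁻¹ p⁻¹ x`, `(diag dD ⊗ 1) ⊗ₖ (a′) = reindex p⁻¹ p⁻¹ (a′ • T^𝔻 ⊗ 1)`, `p = prodUnique`; `diag dD = T^𝔻` by ★ `gramD_eq_diagonal_cm`).
* §2 **`coe_untransportSp_toSp_line`** (line (K-b)): `untransportSp T₁ (j h) = reindex ρ ρ (D_{a′} · U h · D_{a′⁻¹})` for EVERY `h ∈ H(𝔸)` — the `im`-blocks of ★ (K-b) scale by `a′^{±1}`.
* §3 **`lineCayleyMover_mem_symplecticGroup`**: `κ′ := reindex ρ ρ (D_{a′} κ_n D_{a′⁻¹}) ∈ Sp_{2n″}(L⁺)` (rational), and its adelic image.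
* §4 (FILE 2b `K2LiuLinePairCayleySiegelModel`) **`coe_lineCayleyMover_conj_untransportSp_toSp_line`** — the `κ′`-MODEL of `P_Δ(𝔸)` in the line pair: for `h ∈ P_Δ(𝔸)`,
  `κ′_𝔸 · untransportSp T₁ (j h) · κ′_𝔸⁻¹ = reindex ρ ρ (A, 0; a′ • C, A′)` with ★ (K-d)'s blocks `A = D₂ Res(b₁₁ − b₂₁) D₂⁻¹`, `C = J₂ Res(b₂₁ − b₁₂) D₂⁻¹`,
  `A′ = J₂ Res(h|_Δ) J₂⁻¹` VERBATIM; (FILE 2c `K2LiuLinePairCayleySiegelUnipotent`) **`ratSp_lineCayleyMover_conj_toSp_mem_siegelParabolicPi`** — the membership letter `hj` of ★ `adelicSiegelLiftConj'`: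
  `ratSp κ′ · j(p) · (ratSp κ′)⁻¹ ∈ P_𝕐(T₁)` for `p ∈ P_Δ(𝔸)` (★ (K-e) `transportSp_mem_siegelParabolicPi_of_toBlocks₁₂_eq_zero`).
* §5 (FILE 2c) **`coe_lineCayleyMover_conj_untransportSp_toSp_line_of_mem_unipDelta`** ((B1c′-2a) folded in): for `u ∈ N_Δ(𝔸)` the `κ′`-model is the LOWER UNIPOTENT
  `reindex ρ ρ (1, 0; a′ • (J₂ Res(−2 X_u) D₂⁻¹), 1)`, `X_u = (blk u)₁₂` (`b₁₁ − b₂₁ = 1`, `b₂₁ − b₁₂ = −2X_u`, `u|_Δ = 1` on `N_Δ`, ★ `mem_unipDelta_iff_blocks`).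
[Kudla1994, §2–§3 (the doubled space, its Siegel parabolic, the Cayley element)] [GelbartRogawski1991, §3.1 Prop. 3.1.1 p. 455] [HarrisKudlaSweet1996, §1 (1.8), (1.14)–(1.15)]
[Weil1964, Chap. I n° 13 p. 160, Chap. III n° 46 p. 201] [MoeglinVignerasWaldspurger1987, Chap. 2 II.2].
HONEST LABEL.  Count-neutral helper, closes no socket by itself: `HC_CM` is proved only modulo the 7 printed citations (2 remaining named inputs: hLiu418 =
`stmt-HodgeConjecture-24832`, h413 = `stmt-HodgeConjecture-24833`) until rung 0 closes; FACE-D₀ `h2₂` is NOT discharged by this file (FILE 3 + (B1c′-2b) + S-letters tie).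

## References
* [Kudla1994] S. S. Kudla, *Splitting metaplectic covers of dual reductive pairs*, Israel J. Math. 87 (1994): §2–§3.
* [GelbartRogawski1991] S. Gelbart, J. Rogawski, Invent. Math. 105 (1991): §3.1 Prop. 3.1.1 p. 455.
* [HarrisKudlaSweet1996] M. Harris, S. Kudla, W. J. Sweet, J. AMS 9 (1996): §1.   * [Weil1964] A. Weil, Acta Math. 111 (1964): Chap. I n° 13, Chap. III n° 46.
* [MoeglinVignerasWaldspurger1987] C. Mœglin, M.-F. Vignéras, J.-L. Waldspurger, LNM 1291 (1987): Chap. 2 II.2.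
-/

set_option autoImplicit false
-- the mandated namespace repeats the single-problem summit's segment (`HodgeConjecture.HodgeConjecture`)
set_option linter.dupNamespace false

noncomputable section

open scoped Matrix Kronecker
open NumberField IsDedekindDomain

namespace Summit.HodgeConjecture.HodgeConjecture.Cruxes.HLiu418.K2LiuLinePairCayleySiegelModel

open Literature.NumberTheory.Automorphic Literature.NumberTheory.Automorphic.UnitaryGroup
open Literature.NumberTheory.Automorphic.UnitaryGroup.QuadraticCoordinates
open Literature.NumberTheory.Automorphic.UnitaryGroup.SpTransport
open Literature.RepresentationTheory.HeisenbergGroup Literature.RepresentationTheory.HeisenbergGroup.SymplecticMatrix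
open Literature.NumberTheory.GelbartRogawski1991 Literature.NumberTheory.GelbartRogawski1991.GRConstruction
open Literature.NumberTheory.GelbartRogawski1991.UnitaryDualPair
open Literature.NumberTheory.Weil1964
open Literature.NumberTheory.Automorphic.Liu2021 Literature.NumberTheory.Automorphic.Liu2021.Def411WeilCarriers
open Literature.NumberTheory.K2Lit.DoubledLineTheta Literature.NumberTheory.K2Lit.SiegelDoubled
open Summit.HodgeConjecture.HodgeConjecture.Cruxes.HLiu418.K2LiuResAutDarboux (darboux_resAut_darboux_symm)
open Summit.HodgeConjecture.HodgeConjecture.Cruxes.HLiu418.K2LiuDoubledDarbouxDeltaBlocks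
  (reindex_sumCongr_fromBlocks coe_untransportSp_toSpD coe_cayleyMover_conj_untransportSp_toSpD)
open Summit.HodgeConjecture.HodgeConjecture.Cruxes.HLiu418.K2LiuCayleyDeltaSiegelTransfer (transportSp_mem_siegelParabolicPi_of_toBlocks₁₂_eq_zero)
open Summit.HodgeConjecture.HodgeConjecture.Cruxes.HLiu418.K2LiuCayleyMoverFin (reindex_cayleyMoverMatrix_mem_symplecticGroup reindex_cayleyMoverMatrix_map)

open Summit.HodgeConjecture.HodgeConjecture.Cruxes.HLiu418.K2LiuLinePairCayleySiegel
/-! ## §4 The `κ′`-model of `P_Δ(𝔸)` in the line pair -/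

section Model

open Summit.HodgeConjecture.HodgeConjecture.Cruxes.HLiu418.K2LiuDoubledDarbouxDeltaBlocks (reindex_mul_reindex reindex_smul')

variable (L : Type) [Field L] [NumberField L] [IsCMField L]
variable {N M n : ℕ} (e : Fin N × Fin M ≃ Fin n)
  (dV : Fin N → L) (hdV : ∀ i, IsCMField.complexConj L (dV i) = dV i) (hdV0 : ∀ i, dV i ≠ 0)
  (dW : Fin M → L) (hdW : ∀ i, IsCMField.complexConj L (dW i) = dW i) (hdW0 : ∀ i, dW i ≠ 0)
variable {n'' : ℕ} (e₁ : Fin (n + n) × Fin 1 ≃ Fin n'') (a' : (↥(maximalRealSubfield L))ˣ)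

omit [IsCMField L] in
/-- `a′ ⊗ 1` and `a′⁻¹ ⊗ 1` are inverse scalars of `𝔸_{L⁺}`. [folklore] -/
theorem algebraMap_mul_algebraMap_inv :
    algebraMap (Fp L) (AdeleRing (𝓞 (Fp L)) (Fp L)) (a' : Fp L) * algebraMap (Fp L) (AdeleRing (𝓞 (Fp L)) (Fp L)) ((a'⁻¹ : (↥(maximalRealSubfield L))ˣ) : Fp L) = 1 := by
  rw [← map_mul, ← Units.val_mul, mul_inv_cancel, Units.val_one, map_one]

omit [IsCMField L] in
/-- `D_{t}` on `Fin (n+n)` is the `σ = e₂ ⊕ e₂` re-enumeration of `D_{t}` on `Fin n ⊕ Fin n`. [folklore] -/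
theorem diag_eq_reindex (t : (AdeleRing (𝓞 (Fp L)) (Fp L))) :
    Matrix.fromBlocks 1 0 0 (t • (1 : Matrix (Fin (n + n)) (Fin (n + n)) (AdeleRing (𝓞 (Fp L)) (Fp L)))) =
      Matrix.reindex ((e₂ (n := n)).sumCongr (e₂ (n := n))) ((e₂ (n := n)).sumCongr (e₂ (n := n))) (Matrix.fromBlocks 1 0 0 (t • (1 : Matrix (Fin n ⊕ Fin n) (Fin n ⊕ Fin n) (AdeleRing (𝓞 (Fp L)) (Fp L))))) := by
  rw [← fromBlocks_reindex]
  simp only [Matrix.reindex_apply, Matrix.submatrix_one_equiv, Matrix.submatrix_zero, Pi.zero_apply, Matrix.smul_one_eq_diagonal,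
    Matrix.submatrix_diagonal_equiv]
  rfl

include hdV0 hdW0 in
set_option maxHeartbeats 400000 in
-- measured: default 200000 RED (`whnf` on the line datum's `toSp` statement, as FILE 2a §2), 400000 GREEN
/-- **THE `κ′`-MODEL OF `P_Δ(𝔸)` IN THE LINE PAIR.**  For `h ∈ P_Δ(𝔸)` (★ `IsSiegelDelta h`) and ANY `K′ ∈ Sp_{2n″}(𝔸_{L⁺})` with matrix `κ′_𝔸 = ρ (D_{a′} κ_n D_{a′⁻¹})`
(§3 supplies it as `mapHom` of the rational `κ′`):  `K′ · untransportSp T₁ (j h) · K′⁻¹ = reindex ρ ρ (reindex σ σ (A, 0; (a′ ⊗ 1) • C, A′))` with ★ (K-d)'s blocks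
`A = D₂ Res(b₁₁ − b₂₁) D₂⁻¹`, `C = J₂ Res(b₂₁ − b₁₂) D₂⁻¹`, `A′ = J₂ Res(h|_Δ) J₂⁻¹` VERBATIM — §2 ∘ ★ (K-d) `reindex_cayleyMover_mul_untransportSp_toSpD` ∘ §0.
[cite: Kudla1994, §3] [cite: Weil1964, Chap. III n° 46 p. 201] [cite: GelbartRogawski1991, §3.1 Prop. 3.1.1 p. 455] -/
theorem coe_lineCayleyMover_conj_untransportSp_toSp_line
    (hT₁ : IsUnit (adelicGram (Fp L) e₁ (realDiagonal L (dD L e dV hdV dW hdW) (dD_conj L e dV hdV dW hdW)) (TW (Fp L) a')).det)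
    (JW : Matrix (Fin 1) (Fin 1) L) (hV : (realDiagonal L (dD L e dV hdV dW hdW) (dD_conj L e dV hdV dW hdW)).IsSymm) (hW : (TW (Fp L) a').IsSymm)
    (hJV : Matrix.diagonal (dD L e dV hdV dW hdW) = (realDiagonal L (dD L e dV hdV dW hdW) (dD_conj L e dV hdV dW hdW)).map (algebraMap (Fp L) L))
    (hJW : JW = (TW (Fp L) a').map (algebraMap (Fp L) L)) {h : HA L e dV hdV dW hdW} (hS : IsSiegelDelta L e dV hdV dW hdW h)
    (K' : Matrix.symplecticGroup (Fin n'') (AdeleRing (𝓞 (Fp L)) (Fp L)))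
    (hK' : (K' : Matrix (Fin n'' ⊕ Fin n'') (Fin n'' ⊕ Fin n'') (AdeleRing (𝓞 (Fp L)) (Fp L))) =
      Matrix.reindex (((Equiv.prodUnique (Fin (n + n)) (Fin 1)).symm.trans e₁).sumCongr ((Equiv.prodUnique (Fin (n + n)) (Fin 1)).symm.trans e₁))
          (((Equiv.prodUnique (Fin (n + n)) (Fin 1)).symm.trans e₁).sumCongr ((Equiv.prodUnique (Fin (n + n)) (Fin 1)).symm.trans e₁))
        (Matrix.fromBlocks (1 : Matrix (Fin (n + n)) (Fin (n + n)) (AdeleRing (𝓞 (Fp L)) (Fp L))) 0 0 (algebraMap (Fp L) (AdeleRing (𝓞 (Fp L)) (Fp L)) (a' : Fp L) • (1 : Matrix (Fin (n + n)) (Fin (n + n)) (AdeleRing (𝓞 (Fp L)) (Fp L)))) *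
          Matrix.reindex ((e₂ (n := n)).sumCongr (e₂ (n := n))) ((e₂ (n := n)).sumCongr (e₂ (n := n))) (cayleyMoverMatrix (AdeleRing (𝓞 (Fp L)) (Fp L)) (Fin n)) *
          Matrix.fromBlocks (1 : Matrix (Fin (n + n)) (Fin (n + n)) (AdeleRing (𝓞 (Fp L)) (Fp L))) 0 0 (algebraMap (Fp L) (AdeleRing (𝓞 (Fp L)) (Fp L)) ((a'⁻¹ : (↥(maximalRealSubfield L))ˣ) : Fp L) • (1 : Matrix (Fin (n + n)) (Fin (n + n)) (AdeleRing (𝓞 (Fp L)) (Fp L)))))) :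
    ((K' * (untransportSp (adelicGram (Fp L) e₁ (realDiagonal L (dD L e dV hdV dW hdW) (dD_conj L e dV hdV dW hdW)) (TW (Fp L) a')) hT₁
          (toSp (Fp L) L (IsCMField.complexConj L) (n + n) 1 e₁ (Matrix.diagonal (dD L e dV hdV dW hdW)) JW
            (complexConj_imagUnit L) (imagUnit_ne_zero L) (imagUnit_mul_self L) hV hW hJV hJW
            (UnitaryGroup.adelicInl (Fp L) L (IsCMField.complexConj L) (n + n) 1 (Matrix.diagonal (dD L e dV hdV dW hdW)) JW
              (toDiagA L e dV hdV dW hdW h)))) * K'⁻¹ : Matrix.symplecticGroup (Fin n'') (AdeleRing (𝓞 (Fp L)) (Fp L))) :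
        Matrix (Fin n'' ⊕ Fin n'') (Fin n'' ⊕ Fin n'') (AdeleRing (𝓞 (Fp L)) (Fp L))) =
      Matrix.reindex (((Equiv.prodUnique (Fin (n + n)) (Fin 1)).symm.trans e₁).sumCongr ((Equiv.prodUnique (Fin (n + n)) (Fin 1)).symm.trans e₁))
          (((Equiv.prodUnique (Fin (n + n)) (Fin 1)).symm.trans e₁).sumCongr ((Equiv.prodUnique (Fin (n + n)) (Fin 1)).symm.trans e₁))
        (Matrix.reindex ((e₂ (n := n)).sumCongr (e₂ (n := n))) ((e₂ (n := n)).sumCongr (e₂ (n := n)))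
          (Matrix.fromBlocks
          (Matrix.fromBlocks ((2 : (AdeleRing (𝓞 (Fp L)) (Fp L))) • 1) 0 0 1 *
          (Matrix.fromBlocks (((blk L e dV hdV dW hdW h).toBlocks₁₁ - (blk L e dV hdV dW hdW h).toBlocks₂₁).map (re (quadraticAdeleEquiv (Fp L) L (IsCMField.complexConj L) (complexConj_imagUnit L) (imagUnit_ne_zero L)).toAddEquiv))
            ((algebraMap (Fp L) (AdeleRing (𝓞 (Fp L)) (Fp L)) (imagUnitSq L)) • (((blk L e dV hdV dW hdW h).toBlocks₁₁ - (blk L e dV hdV dW hdW h).toBlocks₂₁).map (im (quadraticAdeleEquiv (Fp L) L (IsCMField.complexConj L) (complexConj_imagUnit L) (imagUnit_ne_zero L)).toAddEquiv) * ((gramR L e dV hdV dW hdW).map (algebraMap (Fp L) (AdeleRing (𝓞 (Fp L)) (Fp L))))⁻¹))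
            (((gramR L e dV hdV dW hdW).map (algebraMap (Fp L) (AdeleRing (𝓞 (Fp L)) (Fp L)))) * ((blk L e dV hdV dW hdW h).toBlocks₁₁ - (blk L e dV hdV dW hdW h).toBlocks₂₁).map (im (quadraticAdeleEquiv (Fp L) L (IsCMField.complexConj L) (complexConj_imagUnit L) (imagUnit_ne_zero L)).toAddEquiv))
            (((gramR L e dV hdV dW hdW).map (algebraMap (Fp L) (AdeleRing (𝓞 (Fp L)) (Fp L)))) * ((blk L e dV hdV dW hdW h).toBlocks₁₁ - (blk L e dV hdV dW hdW h).toBlocks₂₁).map (re (quadraticAdeleEquiv (Fp L) L (IsCMField.complexConj L) (complexConj_imagUnit L) (imagUnit_ne_zero L)).toAddEquiv) * ((gramR L e dV hdV dW hdW).map (algebraMap (Fp L) (AdeleRing (𝓞 (Fp L)) (Fp L))))⁻¹)) *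
            Matrix.fromBlocks ((⅟(2 : (AdeleRing (𝓞 (Fp L)) (Fp L)))) • 1) 0 0 1)
          0
          (algebraMap (Fp L) (AdeleRing (𝓞 (Fp L)) (Fp L)) (a' : Fp L) •
          (Matrix.fromBlocks 0 1 (-((2 : (AdeleRing (𝓞 (Fp L)) (Fp L))) • 1)) 0 *
          (Matrix.fromBlocks (((blk L e dV hdV dW hdW h).toBlocks₂₁ - (blk L e dV hdV dW hdW h).toBlocks₁₂).map (re (quadraticAdeleEquiv (Fp L) L (IsCMField.complexConj L) (complexConj_imagUnit L) (imagUnit_ne_zero L)).toAddEquiv))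
            ((algebraMap (Fp L) (AdeleRing (𝓞 (Fp L)) (Fp L)) (imagUnitSq L)) • (((blk L e dV hdV dW hdW h).toBlocks₂₁ - (blk L e dV hdV dW hdW h).toBlocks₁₂).map (im (quadraticAdeleEquiv (Fp L) L (IsCMField.complexConj L) (complexConj_imagUnit L) (imagUnit_ne_zero L)).toAddEquiv) * ((gramR L e dV hdV dW hdW).map (algebraMap (Fp L) (AdeleRing (𝓞 (Fp L)) (Fp L))))⁻¹))
            (((gramR L e dV hdV dW hdW).map (algebraMap (Fp L) (AdeleRing (𝓞 (Fp L)) (Fp L)))) * ((blk L e dV hdV dW hdW h).toBlocks₂₁ - (blk L e dV hdV dW hdW h).toBlocks₁₂).map (im (quadraticAdeleEquiv (Fp L) L (IsCMField.complexConj L) (complexConj_imagUnit L) (imagUnit_ne_zero L)).toAddEquiv))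
            (((gramR L e dV hdV dW hdW).map (algebraMap (Fp L) (AdeleRing (𝓞 (Fp L)) (Fp L)))) * ((blk L e dV hdV dW hdW h).toBlocks₂₁ - (blk L e dV hdV dW hdW h).toBlocks₁₂).map (re (quadraticAdeleEquiv (Fp L) L (IsCMField.complexConj L) (complexConj_imagUnit L) (imagUnit_ne_zero L)).toAddEquiv) * ((gramR L e dV hdV dW hdW).map (algebraMap (Fp L) (AdeleRing (𝓞 (Fp L)) (Fp L))))⁻¹)) *
            Matrix.fromBlocks ((⅟(2 : (AdeleRing (𝓞 (Fp L)) (Fp L)))) • 1) 0 0 1))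
          (Matrix.fromBlocks 0 1 (-((2 : (AdeleRing (𝓞 (Fp L)) (Fp L))) • 1)) 0 *
          (Matrix.fromBlocks ((deltaBlock L e dV hdV dW hdW h).map (re (quadraticAdeleEquiv (Fp L) L (IsCMField.complexConj L) (complexConj_imagUnit L) (imagUnit_ne_zero L)).toAddEquiv))
            ((algebraMap (Fp L) (AdeleRing (𝓞 (Fp L)) (Fp L)) (imagUnitSq L)) • ((deltaBlock L e dV hdV dW hdW h).map (im (quadraticAdeleEquiv (Fp L) L (IsCMField.complexConj L) (complexConj_imagUnit L) (imagUnit_ne_zero L)).toAddEquiv) * ((gramR L e dV hdV dW hdW).map (algebraMap (Fp L) (AdeleRing (𝓞 (Fp L)) (Fp L))))⁻¹))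
            (((gramR L e dV hdV dW hdW).map (algebraMap (Fp L) (AdeleRing (𝓞 (Fp L)) (Fp L)))) * (deltaBlock L e dV hdV dW hdW h).map (im (quadraticAdeleEquiv (Fp L) L (IsCMField.complexConj L) (complexConj_imagUnit L) (imagUnit_ne_zero L)).toAddEquiv))
            (((gramR L e dV hdV dW hdW).map (algebraMap (Fp L) (AdeleRing (𝓞 (Fp L)) (Fp L)))) * (deltaBlock L e dV hdV dW hdW h).map (re (quadraticAdeleEquiv (Fp L) L (IsCMField.complexConj L) (complexConj_imagUnit L) (imagUnit_ne_zero L)).toAddEquiv) * ((gramR L e dV hdV dW hdW).map (algebraMap (Fp L) (AdeleRing (𝓞 (Fp L)) (Fp L))))⁻¹)) *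
            Matrix.fromBlocks 0 (-((⅟(2 : (AdeleRing (𝓞 (Fp L)) (Fp L)))) • 1)) 1 0))) := by
  have hcc' := algebraMap_mul_algebraMap_inv L a'
  have hc'c : algebraMap (Fp L) (AdeleRing (𝓞 (Fp L)) (Fp L)) ((a'⁻¹ : (↥(maximalRealSubfield L))ˣ) : Fp L) * algebraMap (Fp L) (AdeleRing (𝓞 (Fp L)) (Fp L)) (a' : Fp L) = 1 := by rw [mul_comm]; exact hcc'
  -- `D_{a′⁻¹} D_{a′} = 1`
  have hD'D : Matrix.fromBlocks (1 : Matrix (Fin (n + n)) (Fin (n + n)) (AdeleRing (𝓞 (Fp L)) (Fp L))) 0 0 (algebraMap (Fp L) (AdeleRing (𝓞 (Fp L)) (Fp L)) ((a'⁻¹ : (↥(maximalRealSubfield L))ˣ) : Fp L) • (1 : Matrix (Fin (n + n)) (Fin (n + n)) (AdeleRing (𝓞 (Fp L)) (Fp L)))) * Matrix.fromBlocks (1 : Matrix (Fin (n + n)) (Fin (n + n)) (AdeleRing (𝓞 (Fp L)) (Fp L))) 0 0 (algebraMap (Fp L) (AdeleRing (𝓞 (Fp L)) (Fp L)) (a'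 : Fp L) • (1 : Matrix (Fin (n + n)) (Fin (n + n)) (AdeleRing (𝓞 (Fp L)) (Fp L)))) = 1 := by
    rw [Matrix.fromBlocks_multiply]
    simp only [Matrix.mul_one, Matrix.mul_zero, add_zero, zero_add, Matrix.mul_smul, smul_smul, smul_zero, hcc', one_smul, Matrix.fromBlocks_one]
  -- the key commutation `κ′_𝔸 · U′(h) = M′ · κ′_𝔸`
  have key : (K' : Matrix (Fin n'' ⊕ Fin n'') (Fin n'' ⊕ Fin n'') (AdeleRing (𝓞 (Fp L)) (Fp L))) *
      (((untransportSp (adelicGram (Fp L) e₁ (realDiagonal L (dD L e dV hdV dW hdW) (dD_conj L e dV hdV dW hdW)) (TW (Fp L) a')) hT₁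
          (toSp (Fp L) L (IsCMField.complexConj L) (n + n) 1 e₁ (Matrix.diagonal (dD L e dV hdV dW hdW)) JW
            (complexConj_imagUnit L) (imagUnit_ne_zero L) (imagUnit_mul_self L) hV hW hJV hJW
            (UnitaryGroup.adelicInl (Fp L) L (IsCMField.complexConj L) (n + n) 1 (Matrix.diagonal (dD L e dV hdV dW hdW)) JW
              (toDiagA L e dV hdV dW hdW h)))) : Matrix.symplecticGroup (Fin n'') (AdeleRing (𝓞 (Fp L)) (Fp L))) : Matrix (Fin n'' ⊕ Fin n'') (Fin n'' ⊕ Fin n'') (AdeleRing (𝓞 (Fp L)) (Fp L))) =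
      Matrix.reindex (((Equiv.prodUnique (Fin (n + n)) (Fin 1)).symm.trans e₁).sumCongr ((Equiv.prodUnique (Fin (n + n)) (Fin 1)).symm.trans e₁))
          (((Equiv.prodUnique (Fin (n + n)) (Fin 1)).symm.trans e₁).sumCongr ((Equiv.prodUnique (Fin (n + n)) (Fin 1)).symm.trans e₁))
        (Matrix.reindex ((e₂ (n := n)).sumCongr (e₂ (n := n))) ((e₂ (n := n)).sumCongr (e₂ (n := n)))
          (Matrix.fromBlocks
          (Matrix.fromBlocks ((2 : (AdeleRing (𝓞 (Fp L)) (Fp L))) • 1) 0 0 1 *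
          (Matrix.fromBlocks (((blk L e dV hdV dW hdW h).toBlocks₁₁ - (blk L e dV hdV dW hdW h).toBlocks₂₁).map (re (quadraticAdeleEquiv (Fp L) L (IsCMField.complexConj L) (complexConj_imagUnit L) (imagUnit_ne_zero L)).toAddEquiv))
            ((algebraMap (Fp L) (AdeleRing (𝓞 (Fp L)) (Fp L)) (imagUnitSq L)) • (((blk L e dV hdV dW hdW h).toBlocks₁₁ - (blk L e dV hdV dW hdW h).toBlocks₂₁).map (im (quadraticAdeleEquiv (Fp L) L (IsCMField.complexConj L) (complexConj_imagUnit L) (imagUnit_ne_zero L)).toAddEquiv) * ((gramR L e dV hdV dW hdW).map (algebraMap (Fp L) (AdeleRing (𝓞 (Fp L)) (Fp L))))⁻¹))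
            (((gramR L e dV hdV dW hdW).map (algebraMap (Fp L) (AdeleRing (𝓞 (Fp L)) (Fp L)))) * ((blk L e dV hdV dW hdW h).toBlocks₁₁ - (blk L e dV hdV dW hdW h).toBlocks₂₁).map (im (quadraticAdeleEquiv (Fp L) L (IsCMField.complexConj L) (complexConj_imagUnit L) (imagUnit_ne_zero L)).toAddEquiv))
            (((gramR L e dV hdV dW hdW).map (algebraMap (Fp L) (AdeleRing (𝓞 (Fp L)) (Fp L)))) * ((blk L e dV hdV dW hdW h).toBlocks₁₁ - (blk L e dV hdV dW hdW h).toBlocks₂₁).map (re (quadraticAdeleEquiv (Fp L) L (IsCMField.complexConj L) (complexConj_imagUnit L) (imagUnit_ne_zero L)).toAddEquiv) * ((gramR L e dV hdV dW hdW).map (algebraMap (Fp L) (AdeleRing (𝓞 (Fp L)) (Fp L))))⁻¹)) *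
            Matrix.fromBlocks ((⅟(2 : (AdeleRing (𝓞 (Fp L)) (Fp L)))) • 1) 0 0 1)
          0
          (algebraMap (Fp L) (AdeleRing (𝓞 (Fp L)) (Fp L)) (a' : Fp L) •
          (Matrix.fromBlocks 0 1 (-((2 : (AdeleRing (𝓞 (Fp L)) (Fp L))) • 1)) 0 *
          (Matrix.fromBlocks (((blk L e dV hdV dW hdW h).toBlocks₂₁ - (blk L e dV hdV dW hdW h).toBlocks₁₂).map (re (quadraticAdeleEquiv (Fp L) L (IsCMField.complexConj L) (complexConj_imagUnit L) (imagUnit_ne_zero L)).toAddEquiv))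
            ((algebraMap (Fp L) (AdeleRing (𝓞 (Fp L)) (Fp L)) (imagUnitSq L)) • (((blk L e dV hdV dW hdW h).toBlocks₂₁ - (blk L e dV hdV dW hdW h).toBlocks₁₂).map (im (quadraticAdeleEquiv (Fp L) L (IsCMField.complexConj L) (complexConj_imagUnit L) (imagUnit_ne_zero L)).toAddEquiv) * ((gramR L e dV hdV dW hdW).map (algebraMap (Fp L) (AdeleRing (𝓞 (Fp L)) (Fp L))))⁻¹))
            (((gramR L e dV hdV dW hdW).map (algebraMap (Fp L) (AdeleRing (𝓞 (Fp L)) (Fp L)))) * ((blk L e dV hdV dW hdW h).toBlocks₂₁ - (blk L e dV hdV dW hdW h).toBlocks₁₂).map (im (quadraticAdeleEquiv (Fp L) L (IsCMField.complexConj L) (complexConj_imagUnit L) (imagUnit_ne_zero L)).toAddEquiv))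
            (((gramR L e dV hdV dW hdW).map (algebraMap (Fp L) (AdeleRing (𝓞 (Fp L)) (Fp L)))) * ((blk L e dV hdV dW hdW h).toBlocks₂₁ - (blk L e dV hdV dW hdW h).toBlocks₁₂).map (re (quadraticAdeleEquiv (Fp L) L (IsCMField.complexConj L) (complexConj_imagUnit L) (imagUnit_ne_zero L)).toAddEquiv) * ((gramR L e dV hdV dW hdW).map (algebraMap (Fp L) (AdeleRing (𝓞 (Fp L)) (Fp L))))⁻¹)) *
            Matrix.fromBlocks ((⅟(2 : (AdeleRing (𝓞 (Fp L)) (Fp L)))) • 1) 0 0 1))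
          (Matrix.fromBlocks 0 1 (-((2 : (AdeleRing (𝓞 (Fp L)) (Fp L))) • 1)) 0 *
          (Matrix.fromBlocks ((deltaBlock L e dV hdV dW hdW h).map (re (quadraticAdeleEquiv (Fp L) L (IsCMField.complexConj L) (complexConj_imagUnit L) (imagUnit_ne_zero L)).toAddEquiv))
            ((algebraMap (Fp L) (AdeleRing (𝓞 (Fp L)) (Fp L)) (imagUnitSq L)) • ((deltaBlock L e dV hdV dW hdW h).map (im (quadraticAdeleEquiv (Fp L) L (IsCMField.complexConj L) (complexConj_imagUnit L) (imagUnit_ne_zero L)).toAddEquiv) * ((gramR L e dV hdV dW hdW).map (algebraMap (Fp L) (AdeleRing (𝓞 (Fp L)) (Fp L))))⁻¹))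
            (((gramR L e dV hdV dW hdW).map (algebraMap (Fp L) (AdeleRing (𝓞 (Fp L)) (Fp L)))) * (deltaBlock L e dV hdV dW hdW h).map (im (quadraticAdeleEquiv (Fp L) L (IsCMField.complexConj L) (complexConj_imagUnit L) (imagUnit_ne_zero L)).toAddEquiv))
            (((gramR L e dV hdV dW hdW).map (algebraMap (Fp L) (AdeleRing (𝓞 (Fp L)) (Fp L)))) * (deltaBlock L e dV hdV dW hdW h).map (re (quadraticAdeleEquiv (Fp L) L (IsCMField.complexConj L) (complexConj_imagUnit L) (imagUnit_ne_zero L)).toAddEquiv) * ((gramR L e dV hdV dW hdW).map (algebraMap (Fp L) (AdeleRing (𝓞 (Fp L)) (Fp L))))⁻¹)) *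
            Matrix.fromBlocks 0 (-((⅟(2 : (AdeleRing (𝓞 (Fp L)) (Fp L)))) • 1)) 1 0))) * (K' : Matrix (Fin n'' ⊕ Fin n'') (Fin n'' ⊕ Fin n'') (AdeleRing (𝓞 (Fp L)) (Fp L))) := by
    rw [hK', coe_untransportSp_toSp_line L e dV hdV hdV0 dW hdW hdW0 e₁ a' hT₁ JW hV hW hJV hJW h, reindex_mul_reindex, reindex_mul_reindex]
    congr 1
    calc Matrix.fromBlocks (1 : Matrix (Fin (n + n)) (Fin (n + n)) (AdeleRing (𝓞 (Fp L)) (Fp L))) 0 0 (algebraMap (Fp L) (AdeleRing (𝓞 (Fp L)) (Fp L)) (a' : Fp L) • (1 : Matrix (Fin (n + n)) (Fin (n + n)) (AdeleRing (𝓞 (Fp L)) (Fp L)))) * Matrix.reindex ((e₂ (n := n)).sumCongr (e₂ (n := n))) ((e₂ (n := n)).sumCongr (e₂ (n := n))) (cayleyMoverMatrix (AdeleRing (𝓞 (Fp L)) (Fp L)) (Fin n)) * Matrix.fromBlocks (1 : Matrix (Fin (n + n)) (Fin (n + n)) (AdeleRing (𝓞 (Fp L)) (Fp L))) 0 0 (algebraMap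 (Fp L) (AdeleRing (𝓞 (Fp L)) (Fp L)) ((a'⁻¹ : (↥(maximalRealSubfield L))ˣ) : Fp L) • (1 : Matrix (Fin (n + n)) (Fin (n + n)) (AdeleRing (𝓞 (Fp L)) (Fp L)))) *
          (Matrix.fromBlocks (1 : Matrix (Fin (n + n)) (Fin (n + n)) (AdeleRing (𝓞 (Fp L)) (Fp L))) 0 0 (algebraMap (Fp L) (AdeleRing (𝓞 (Fp L)) (Fp L)) (a' : Fp L) • (1 : Matrix (Fin (n + n)) (Fin (n + n)) (AdeleRing (𝓞 (Fp L)) (Fp L)))) *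
            ((untransportSp (gramDA L e dV hdV dW hdW) (isUnit_det_gramDA L e dV hdV hdV0 dW hdW hdW0) (toSpD L e dV hdV dW hdW h) :
                Matrix.symplecticGroup (Fin (n + n)) (AdeleRing (𝓞 (Fp L)) (Fp L))) : Matrix (Fin (n + n) ⊕ Fin (n + n)) (Fin (n + n) ⊕ Fin (n + n)) (AdeleRing (𝓞 (Fp L)) (Fp L))) *
            Matrix.fromBlocks (1 : Matrix (Fin (n + n)) (Fin (n + n)) (AdeleRing (𝓞 (Fp L)) (Fp L))) 0 0 (algebraMap (Fp L) (AdeleRing (𝓞 (Fp L)) (Fp L)) ((a'⁻¹ : (↥(maximalRealSubfield L))ˣ) : Fp L) • (1 : Matrix (Fin (n + n)) (Fin (n + n)) (AdeleRing (𝓞 (Fp L)) (Fp L)))))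
        = Matrix.fromBlocks (1 : Matrix (Fin (n + n)) (Fin (n + n)) (AdeleRing (𝓞 (Fp L)) (Fp L))) 0 0 (algebraMap (Fp L) (AdeleRing (𝓞 (Fp L)) (Fp L)) (a' : Fp L) • (1 : Matrix (Fin (n + n)) (Fin (n + n)) (AdeleRing (𝓞 (Fp L)) (Fp L)))) * (Matrix.reindex ((e₂ (n := n)).sumCongr (e₂ (n := n))) ((e₂ (n := n)).sumCongr (e₂ (n := n))) (cayleyMoverMatrix (AdeleRing (𝓞 (Fp L)) (Fp L)) (Fin n)) * (Matrix.fromBlocks (1 : Matrix (Fin (n + n)) (Fin (n + n)) (AdeleRing (𝓞 (Fp L)) (Fp L))) 0 0 (algebraMap (Fp L) (AdeleRing (𝓞 (Fp L)) (Fp L)) ((a'⁻¹ : (↥(maximalRealSubfield L))ˣ) : Fp L) • (1 : Matrix (Fin (n + n)) (Fin (n + n)) (AdeleRing (𝓞 (Fp L)) (Fp L)))) * Matrix.fromBlocks (1 : Matrix (Fin (n + n)) (Fin (n + n)) (AdeleRing (𝓞 (Fp L)) (Fp L))) 0 0 (algebraMap (Fp L) (AdeleRing (𝓞 (Fp L))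 (Fp L)) (a' : Fp L) • (1 : Matrix (Fin (n + n)) (Fin (n + n)) (AdeleRing (𝓞 (Fp L)) (Fp L))))) *
            ((untransportSp (gramDA L e dV hdV dW hdW) (isUnit_det_gramDA L e dV hdV hdV0 dW hdW hdW0) (toSpD L e dV hdV dW hdW h) :
                Matrix.symplecticGroup (Fin (n + n)) (AdeleRing (𝓞 (Fp L)) (Fp L))) : Matrix (Fin (n + n) ⊕ Fin (n + n)) (Fin (n + n) ⊕ Fin (n + n)) (AdeleRing (𝓞 (Fp L)) (Fp L)))) *
          Matrix.fromBlocks (1 : Matrix (Fin (n + n)) (Fin (n + n)) (AdeleRing (𝓞 (Fp L)) (Fp L))) 0 0 (algebraMap (Fp L) (AdeleRing (𝓞 (Fp L)) (Fp L)) ((a'⁻¹ : (↥(maximalRealSubfield L))ˣ) : Fp L) • (1 : Matrix (Fin (n + n)) (Fin (n + n)) (AdeleRing (𝓞 (Fp L)) (Fp L)))) := by simp only [Matrix.mul_assoc]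
      _ = Matrix.fromBlocks (1 : Matrix (Fin (n + n)) (Fin (n + n)) (AdeleRing (𝓞 (Fp L)) (Fp L))) 0 0 (algebraMap (Fp L) (AdeleRing (𝓞 (Fp L)) (Fp L)) (a' : Fp L) • (1 : Matrix (Fin (n + n)) (Fin (n + n)) (AdeleRing (𝓞 (Fp L)) (Fp L)))) *
          ((Matrix.reindex ((e₂ (n := n)).sumCongr (e₂ (n := n))) ((e₂ (n := n)).sumCongr (e₂ (n := n)))
        (Matrix.fromBlocks
          (Matrix.fromBlocks ((2 : (AdeleRing (𝓞 (Fp L)) (Fp L))) • 1) 0 0 1 *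
          (Matrix.fromBlocks (((blk L e dV hdV dW hdW h).toBlocks₁₁ - (blk L e dV hdV dW hdW h).toBlocks₂₁).map (re (quadraticAdeleEquiv (Fp L) L (IsCMField.complexConj L) (complexConj_imagUnit L) (imagUnit_ne_zero L)).toAddEquiv))
            ((algebraMap (Fp L) (AdeleRing (𝓞 (Fp L)) (Fp L)) (imagUnitSq L)) • (((blk L e dV hdV dW hdW h).toBlocks₁₁ - (blk L e dV hdV dW hdW h).toBlocks₂₁).map (im (quadraticAdeleEquiv (Fp L) L (IsCMField.complexConj L) (complexConj_imagUnit L) (imagUnit_ne_zero L)).toAddEquiv) * ((gramR L e dV hdV dW hdW).map (algebraMap (Fp L) (AdeleRing (𝓞 (Fp L)) (Fp L))))⁻¹))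
            (((gramR L e dV hdV dW hdW).map (algebraMap (Fp L) (AdeleRing (𝓞 (Fp L)) (Fp L)))) * ((blk L e dV hdV dW hdW h).toBlocks₁₁ - (blk L e dV hdV dW hdW h).toBlocks₂₁).map (im (quadraticAdeleEquiv (Fp L) L (IsCMField.complexConj L) (complexConj_imagUnit L) (imagUnit_ne_zero L)).toAddEquiv))
            (((gramR L e dV hdV dW hdW).map (algebraMap (Fp L) (AdeleRing (𝓞 (Fp L)) (Fp L)))) * ((blk L e dV hdV dW hdW h).toBlocks₁₁ - (blk L e dV hdV dW hdW h).toBlocks₂₁).map (re (quadraticAdeleEquiv (Fp L) L (IsCMField.complexConj L) (complexConj_imagUnit L) (imagUnit_ne_zero L)).toAddEquiv) * ((gramR L e dV hdV dW hdW).map (algebraMap (Fp L) (AdeleRing (𝓞 (Fp L)) (Fp L))))⁻¹)) *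
            Matrix.fromBlocks ((⅟(2 : (AdeleRing (𝓞 (Fp L)) (Fp L)))) • 1) 0 0 1)
          0
          (Matrix.fromBlocks 0 1 (-((2 : (AdeleRing (𝓞 (Fp L)) (Fp L))) • 1)) 0 *
          (Matrix.fromBlocks (((blk L e dV hdV dW hdW h).toBlocks₂₁ - (blk L e dV hdV dW hdW h).toBlocks₁₂).map (re (quadraticAdeleEquiv (Fp L) L (IsCMField.complexConj L) (complexConj_imagUnit L) (imagUnit_ne_zero L)).toAddEquiv))
            ((algebraMap (Fp L) (AdeleRing (𝓞 (Fp L)) (Fp L)) (imagUnitSq L)) • (((blk L e dV hdV dW hdW h).toBlocks₂₁ - (blk L e dV hdV dW hdW h).toBlocks₁₂).map (im (quadraticAdeleEquiv (Fp L) L (IsCMField.complexConj L) (complexConj_imagUnit L) (imagUnit_ne_zero L)).toAddEquiv) * ((gramR L e dV hdV dW hdW).map (algebraMap (Fp L) (AdeleRing (𝓞 (Fp L)) (Fp L))))⁻¹))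
            (((gramR L e dV hdV dW hdW).map (algebraMap (Fp L) (AdeleRing (𝓞 (Fp L)) (Fp L)))) * ((blk L e dV hdV dW hdW h).toBlocks₂₁ - (blk L e dV hdV dW hdW h).toBlocks₁₂).map (im (quadraticAdeleEquiv (Fp L) L (IsCMField.complexConj L) (complexConj_imagUnit L) (imagUnit_ne_zero L)).toAddEquiv))
            (((gramR L e dV hdV dW hdW).map (algebraMap (Fp L) (AdeleRing (𝓞 (Fp L)) (Fp L)))) * ((blk L e dV hdV dW hdW h).toBlocks₂₁ - (blk L e dV hdV dW hdW h).toBlocks₁₂).map (re (quadraticAdeleEquiv (Fp L) L (IsCMField.complexConj L) (complexConj_imagUnit L) (imagUnit_ne_zero L)).toAddEquiv) * ((gramR L e dV hdV dW hdW).map (algebraMap (Fp L) (AdeleRing (𝓞 (Fp L)) (Fp L))))⁻¹)) *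
            Matrix.fromBlocks ((⅟(2 : (AdeleRing (𝓞 (Fp L)) (Fp L)))) • 1) 0 0 1)
          (Matrix.fromBlocks 0 1 (-((2 : (AdeleRing (𝓞 (Fp L)) (Fp L))) • 1)) 0 *
          (Matrix.fromBlocks ((deltaBlock L e dV hdV dW hdW h).map (re (quadraticAdeleEquiv (Fp L) L (IsCMField.complexConj L) (complexConj_imagUnit L) (imagUnit_ne_zero L)).toAddEquiv))
            ((algebraMap (Fp L) (AdeleRing (𝓞 (Fp L)) (Fp L)) (imagUnitSq L)) • ((deltaBlock L e dV hdV dW hdW h).map (im (quadraticAdeleEquiv (Fp L) L (IsCMField.complexConj L) (complexConj_imagUnit L) (imagUnit_ne_zero L)).toAddEquiv) * ((gramR L e dV hdV dW hdW).map (algebraMap (Fp L) (AdeleRing (𝓞 (Fp L)) (Fp L))))⁻¹))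
            (((gramR L e dV hdV dW hdW).map (algebraMap (Fp L) (AdeleRing (𝓞 (Fp L)) (Fp L)))) * (deltaBlock L e dV hdV dW hdW h).map (im (quadraticAdeleEquiv (Fp L) L (IsCMField.complexConj L) (complexConj_imagUnit L) (imagUnit_ne_zero L)).toAddEquiv))
            (((gramR L e dV hdV dW hdW).map (algebraMap (Fp L) (AdeleRing (𝓞 (Fp L)) (Fp L)))) * (deltaBlock L e dV hdV dW hdW h).map (re (quadraticAdeleEquiv (Fp L) L (IsCMField.complexConj L) (complexConj_imagUnit L) (imagUnit_ne_zero L)).toAddEquiv) * ((gramR L e dV hdV dW hdW).map (algebraMap (Fp L) (AdeleRing (𝓞 (Fp L)) (Fp L))))⁻¹)) *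
            Matrix.fromBlocks 0 (-((⅟(2 : (AdeleRing (𝓞 (Fp L)) (Fp L)))) • 1)) 1 0))) * Matrix.reindex ((e₂ (n := n)).sumCongr (e₂ (n := n))) ((e₂ (n := n)).sumCongr (e₂ (n := n))) (cayleyMoverMatrix (AdeleRing (𝓞 (Fp L)) (Fp L)) (Fin n))) * Matrix.fromBlocks (1 : Matrix (Fin (n + n)) (Fin (n + n)) (AdeleRing (𝓞 (Fp L)) (Fp L))) 0 0 (algebraMap (Fp L) (AdeleRing (𝓞 (Fp L)) (Fp L)) ((a'⁻¹ : (↥(maximalRealSubfield L))ˣ) : Fp L) • (1 : Matrix (Fin (n + n)) (Fin (n + n)) (AdeleRing (𝓞 (Fp L)) (Fp L)))) := by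
          rw [hD'D, Matrix.mul_one, K2LiuDoubledDarbouxDeltaBlocks.reindex_cayleyMover_mul_untransportSp_toSpD L e dV hdV hdV0 dW hdW hdW0 hS]
      _ = Matrix.fromBlocks (1 : Matrix (Fin (n + n)) (Fin (n + n)) (AdeleRing (𝓞 (Fp L)) (Fp L))) 0 0 (algebraMap (Fp L) (AdeleRing (𝓞 (Fp L)) (Fp L)) (a' : Fp L) • (1 : Matrix (Fin (n + n)) (Fin (n + n)) (AdeleRing (𝓞 (Fp L)) (Fp L)))) * (Matrix.reindex ((e₂ (n := n)).sumCongr (e₂ (n := n))) ((e₂ (n := n)).sumCongr (e₂ (n := n)))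
        (Matrix.fromBlocks
          (Matrix.fromBlocks ((2 : (AdeleRing (𝓞 (Fp L)) (Fp L))) • 1) 0 0 1 *
          (Matrix.fromBlocks (((blk L e dV hdV dW hdW h).toBlocks₁₁ - (blk L e dV hdV dW hdW h).toBlocks₂₁).map (re (quadraticAdeleEquiv (Fp L) L (IsCMField.complexConj L) (complexConj_imagUnit L) (imagUnit_ne_zero L)).toAddEquiv))
            ((algebraMap (Fp L) (AdeleRing (𝓞 (Fp L)) (Fp L)) (imagUnitSq L)) • (((blk L e dV hdV dW hdW h).toBlocks₁₁ - (blk L e dV hdV dW hdW h).toBlocks₂₁).map (im (quadraticAdeleEquiv (Fp L) L (IsCMField.complexConj L) (complexConj_imagUnit L) (imagUnit_ne_zero L)).toAddEquiv) * ((gramR L e dV hdV dW hdW).map (algebraMap (Fp L) (AdeleRing (𝓞 (Fp L)) (Fp L))))⁻¹))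
            (((gramR L e dV hdV dW hdW).map (algebraMap (Fp L) (AdeleRing (𝓞 (Fp L)) (Fp L)))) * ((blk L e dV hdV dW hdW h).toBlocks₁₁ - (blk L e dV hdV dW hdW h).toBlocks₂₁).map (im (quadraticAdeleEquiv (Fp L) L (IsCMField.complexConj L) (complexConj_imagUnit L) (imagUnit_ne_zero L)).toAddEquiv))
            (((gramR L e dV hdV dW hdW).map (algebraMap (Fp L) (AdeleRing (𝓞 (Fp L)) (Fp L)))) * ((blk L e dV hdV dW hdW h).toBlocks₁₁ - (blk L e dV hdV dW hdW h).toBlocks₂₁).map (re (quadraticAdeleEquiv (Fp L) L (IsCMField.complexConj L) (complexConj_imagUnit L) (imagUnit_ne_zero L)).toAddEquiv) * ((gramR L e dV hdV dW hdW).map (algebraMap (Fp L) (AdeleRing (𝓞 (Fp L)) (Fp L))))⁻¹)) *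
            Matrix.fromBlocks ((⅟(2 : (AdeleRing (𝓞 (Fp L)) (Fp L)))) • 1) 0 0 1)
          0
          (Matrix.fromBlocks 0 1 (-((2 : (AdeleRing (𝓞 (Fp L)) (Fp L))) • 1)) 0 *
          (Matrix.fromBlocks (((blk L e dV hdV dW hdW h).toBlocks₂₁ - (blk L e dV hdV dW hdW h).toBlocks₁₂).map (re (quadraticAdeleEquiv (Fp L) L (IsCMField.complexConj L) (complexConj_imagUnit L) (imagUnit_ne_zero L)).toAddEquiv))
            ((algebraMap (Fp L) (AdeleRing (𝓞 (Fp L)) (Fp L)) (imagUnitSq L)) • (((blk L e dV hdV dW hdW h).toBlocks₂₁ - (blk L e dV hdV dW hdW h).toBlocks₁₂).map (im (quadraticAdeleEquiv (Fp L) L (IsCMField.complexConj L) (complexConj_imagUnit L) (imagUnit_ne_zero L)).toAddEquiv) * ((gramR L e dV hdV dW hdW).map (algebraMap (Fp L) (AdeleRing (𝓞 (Fp L)) (Fp L))))⁻¹))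
            (((gramR L e dV hdV dW hdW).map (algebraMap (Fp L) (AdeleRing (𝓞 (Fp L)) (Fp L)))) * ((blk L e dV hdV dW hdW h).toBlocks₂₁ - (blk L e dV hdV dW hdW h).toBlocks₁₂).map (im (quadraticAdeleEquiv (Fp L) L (IsCMField.complexConj L) (complexConj_imagUnit L) (imagUnit_ne_zero L)).toAddEquiv))
            (((gramR L e dV hdV dW hdW).map (algebraMap (Fp L) (AdeleRing (𝓞 (Fp L)) (Fp L)))) * ((blk L e dV hdV dW hdW h).toBlocks₂₁ - (blk L e dV hdV dW hdW h).toBlocks₁₂).map (re (quadraticAdeleEquiv (Fp L) L (IsCMField.complexConj L) (complexConj_imagUnit L) (imagUnit_ne_zero L)).toAddEquiv) * ((gramR L e dV hdV dW hdW).map (algebraMap (Fp L) (AdeleRing (𝓞 (Fp L)) (Fp L))))⁻¹)) *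
            Matrix.fromBlocks ((⅟(2 : (AdeleRing (𝓞 (Fp L)) (Fp L)))) • 1) 0 0 1)
          (Matrix.fromBlocks 0 1 (-((2 : (AdeleRing (𝓞 (Fp L)) (Fp L))) • 1)) 0 *
          (Matrix.fromBlocks ((deltaBlock L e dV hdV dW hdW h).map (re (quadraticAdeleEquiv (Fp L) L (IsCMField.complexConj L) (complexConj_imagUnit L) (imagUnit_ne_zero L)).toAddEquiv))
            ((algebraMap (Fp L) (AdeleRing (𝓞 (Fp L)) (Fp L)) (imagUnitSq L)) • ((deltaBlock L e dV hdV dW hdW h).map (im (quadraticAdeleEquiv (Fp L) L (IsCMField.complexConj L) (complexConj_imagUnit L) (imagUnit_ne_zero L)).toAddEquiv) * ((gramR L e dV hdV dW hdW).map (algebraMap (Fp L) (AdeleRing (𝓞 (Fp L)) (Fp L))))⁻¹))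
            (((gramR L e dV hdV dW hdW).map (algebraMap (Fp L) (AdeleRing (𝓞 (Fp L)) (Fp L)))) * (deltaBlock L e dV hdV dW hdW h).map (im (quadraticAdeleEquiv (Fp L) L (IsCMField.complexConj L) (complexConj_imagUnit L) (imagUnit_ne_zero L)).toAddEquiv))
            (((gramR L e dV hdV dW hdW).map (algebraMap (Fp L) (AdeleRing (𝓞 (Fp L)) (Fp L)))) * (deltaBlock L e dV hdV dW hdW h).map (re (quadraticAdeleEquiv (Fp L) L (IsCMField.complexConj L) (complexConj_imagUnit L) (imagUnit_ne_zero L)).toAddEquiv) * ((gramR L e dV hdV dW hdW).map (algebraMap (Fp L) (AdeleRing (𝓞 (Fp L)) (Fp L))))⁻¹)) *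
            Matrix.fromBlocks 0 (-((⅟(2 : (AdeleRing (𝓞 (Fp L)) (Fp L)))) • 1)) 1 0))) * (Matrix.fromBlocks (1 : Matrix (Fin (n + n)) (Fin (n + n)) (AdeleRing (𝓞 (Fp L)) (Fp L))) 0 0 (algebraMap (Fp L) (AdeleRing (𝓞 (Fp L)) (Fp L)) ((a'⁻¹ : (↥(maximalRealSubfield L))ˣ) : Fp L) • (1 : Matrix (Fin (n + n)) (Fin (n + n)) (AdeleRing (𝓞 (Fp L)) (Fp L)))) * Matrix.fromBlocks (1 : Matrix (Fin (n + n)) (Fin (n + n)) (AdeleRing (𝓞 (Fp L)) (Fp L))) 0 0 (algebraMap (Fp L) (AdeleRing (𝓞 (Fp L)) (Fp L)) (a' : Fp L) • (1 : Matrix (Fin (n + n)) (Fin (n + n)) (AdeleRing (𝓞 (Fp L)) (Fp L))))) * Matrix.reindex ((e₂ (n := n)).sumCongr (e₂ (n := n))) ((e₂ (n := n)).sumCongr (e₂ (n := n))) (cayleyMoverMatrix (AdeleRing (𝓞 (Fp L)) (Fp L)) (Fin n)) * Matrix.fromBlocks (1 : Matrix (Fin (n + n)) (Fin (n + n)) (AdeleRing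 (𝓞 (Fp L)) (Fp L))) 0 0 (algebraMap (Fp L) (AdeleRing (𝓞 (Fp L)) (Fp L)) ((a'⁻¹ : (↥(maximalRealSubfield L))ˣ) : Fp L) • (1 : Matrix (Fin (n + n)) (Fin (n + n)) (AdeleRing (𝓞 (Fp L)) (Fp L)))) := by
          rw [hD'D, Matrix.mul_one]; simp only [Matrix.mul_assoc]
      _ = (Matrix.fromBlocks (1 : Matrix (Fin (n + n)) (Fin (n + n)) (AdeleRing (𝓞 (Fp L)) (Fp L))) 0 0 (algebraMap (Fp L) (AdeleRing (𝓞 (Fp L)) (Fp L)) (a' : Fp L) • (1 : Matrix (Fin (n + n)) (Fin (n + n)) (AdeleRing (𝓞 (Fp L)) (Fp L)))) * (Matrix.reindex ((e₂ (n := n)).sumCongr (e₂ (n := n))) ((e₂ (n := n)).sumCongr (e₂ (n := n)))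
        (Matrix.fromBlocks
          (Matrix.fromBlocks ((2 : (AdeleRing (𝓞 (Fp L)) (Fp L))) • 1) 0 0 1 *
          (Matrix.fromBlocks (((blk L e dV hdV dW hdW h).toBlocks₁₁ - (blk L e dV hdV dW hdW h).toBlocks₂₁).map (re (quadraticAdeleEquiv (Fp L) L (IsCMField.complexConj L) (complexConj_imagUnit L) (imagUnit_ne_zero L)).toAddEquiv))
            ((algebraMap (Fp L) (AdeleRing (𝓞 (Fp L)) (Fp L)) (imagUnitSq L)) • (((blk L e dV hdV dW hdW h).toBlocks₁₁ - (blk L e dV hdV dW hdW h).toBlocks₂₁).map (im (quadraticAdeleEquiv (Fp L) L (IsCMField.complexConj L) (complexConj_imagUnit L) (imagUnit_ne_zero L)).toAddEquiv) * ((gramR L e dV hdV dW hdW).map (algebraMap (Fp L) (AdeleRing (𝓞 (Fp L)) (Fp L))))⁻¹))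
            (((gramR L e dV hdV dW hdW).map (algebraMap (Fp L) (AdeleRing (𝓞 (Fp L)) (Fp L)))) * ((blk L e dV hdV dW hdW h).toBlocks₁₁ - (blk L e dV hdV dW hdW h).toBlocks₂₁).map (im (quadraticAdeleEquiv (Fp L) L (IsCMField.complexConj L) (complexConj_imagUnit L) (imagUnit_ne_zero L)).toAddEquiv))
            (((gramR L e dV hdV dW hdW).map (algebraMap (Fp L) (AdeleRing (𝓞 (Fp L)) (Fp L)))) * ((blk L e dV hdV dW hdW h).toBlocks₁₁ - (blk L e dV hdV dW hdW h).toBlocks₂₁).map (re (quadraticAdeleEquiv (Fp L) L (IsCMField.complexConj L) (complexConj_imagUnit L) (imagUnit_ne_zero L)).toAddEquiv) * ((gramR L e dV hdV dW hdW).map (algebraMap (Fp L) (AdeleRing (𝓞 (Fp L)) (Fp L))))⁻¹)) *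
            Matrix.fromBlocks ((⅟(2 : (AdeleRing (𝓞 (Fp L)) (Fp L)))) • 1) 0 0 1)
          0
          (Matrix.fromBlocks 0 1 (-((2 : (AdeleRing (𝓞 (Fp L)) (Fp L))) • 1)) 0 *
          (Matrix.fromBlocks (((blk L e dV hdV dW hdW h).toBlocks₂₁ - (blk L e dV hdV dW hdW h).toBlocks₁₂).map (re (quadraticAdeleEquiv (Fp L) L (IsCMField.complexConj L) (complexConj_imagUnit L) (imagUnit_ne_zero L)).toAddEquiv))
            ((algebraMap (Fp L) (AdeleRing (𝓞 (Fp L)) (Fp L)) (imagUnitSq L)) • (((blk L e dV hdV dW hdW h).toBlocks₂₁ - (blk L e dV hdV dW hdW h).toBlocks₁₂).map (im (quadraticAdeleEquiv (Fp L) L (IsCMField.complexConj L) (complexConj_imagUnit L) (imagUnit_ne_zero L)).toAddEquiv) * ((gramR L e dV hdV dW hdW).map (algebraMap (Fp L) (AdeleRing (𝓞 (Fp L)) (Fp L))))⁻¹))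
            (((gramR L e dV hdV dW hdW).map (algebraMap (Fp L) (AdeleRing (𝓞 (Fp L)) (Fp L)))) * ((blk L e dV hdV dW hdW h).toBlocks₂₁ - (blk L e dV hdV dW hdW h).toBlocks₁₂).map (im (quadraticAdeleEquiv (Fp L) L (IsCMField.complexConj L) (complexConj_imagUnit L) (imagUnit_ne_zero L)).toAddEquiv))
            (((gramR L e dV hdV dW hdW).map (algebraMap (Fp L) (AdeleRing (𝓞 (Fp L)) (Fp L)))) * ((blk L e dV hdV dW hdW h).toBlocks₂₁ - (blk L e dV hdV dW hdW h).toBlocks₁₂).map (re (quadraticAdeleEquiv (Fp L) L (IsCMField.complexConj L) (complexConj_imagUnit L) (imagUnit_ne_zero L)).toAddEquiv) * ((gramR L e dV hdV dW hdW).map (algebraMap (Fp L) (AdeleRing (𝓞 (Fp L)) (Fp L))))⁻¹)) *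
            Matrix.fromBlocks ((⅟(2 : (AdeleRing (𝓞 (Fp L)) (Fp L)))) • 1) 0 0 1)
          (Matrix.fromBlocks 0 1 (-((2 : (AdeleRing (𝓞 (Fp L)) (Fp L))) • 1)) 0 *
          (Matrix.fromBlocks ((deltaBlock L e dV hdV dW hdW h).map (re (quadraticAdeleEquiv (Fp L) L (IsCMField.complexConj L) (complexConj_imagUnit L) (imagUnit_ne_zero L)).toAddEquiv))
            ((algebraMap (Fp L) (AdeleRing (𝓞 (Fp L)) (Fp L)) (imagUnitSq L)) • ((deltaBlock L e dV hdV dW hdW h).map (im (quadraticAdeleEquiv (Fp L) L (IsCMField.complexConj L) (complexConj_imagUnit L) (imagUnit_ne_zero L)).toAddEquiv) * ((gramR L e dV hdV dW hdW).map (algebraMap (Fp L) (AdeleRing (𝓞 (Fp L)) (Fp L))))⁻¹))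
            (((gramR L e dV hdV dW hdW).map (algebraMap (Fp L) (AdeleRing (𝓞 (Fp L)) (Fp L)))) * (deltaBlock L e dV hdV dW hdW h).map (im (quadraticAdeleEquiv (Fp L) L (IsCMField.complexConj L) (complexConj_imagUnit L) (imagUnit_ne_zero L)).toAddEquiv))
            (((gramR L e dV hdV dW hdW).map (algebraMap (Fp L) (AdeleRing (𝓞 (Fp L)) (Fp L)))) * (deltaBlock L e dV hdV dW hdW h).map (re (quadraticAdeleEquiv (Fp L) L (IsCMField.complexConj L) (complexConj_imagUnit L) (imagUnit_ne_zero L)).toAddEquiv) * ((gramR L e dV hdV dW hdW).map (algebraMap (Fp L) (AdeleRing (𝓞 (Fp L)) (Fp L))))⁻¹)) *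
            Matrix.fromBlocks 0 (-((⅟(2 : (AdeleRing (𝓞 (Fp L)) (Fp L)))) • 1)) 1 0))) * Matrix.fromBlocks (1 : Matrix (Fin (n + n)) (Fin (n + n)) (AdeleRing (𝓞 (Fp L)) (Fp L))) 0 0 (algebraMap (Fp L) (AdeleRing (𝓞 (Fp L)) (Fp L)) ((a'⁻¹ : (↥(maximalRealSubfield L))ˣ) : Fp L) • (1 : Matrix (Fin (n + n)) (Fin (n + n)) (AdeleRing (𝓞 (Fp L)) (Fp L))))) * (Matrix.fromBlocks (1 : Matrix (Fin (n + n)) (Fin (n + n)) (AdeleRing (𝓞 (Fp L)) (Fp L))) 0 0 (algebraMap (Fp L) (AdeleRing (𝓞 (Fp L)) (Fp L)) (a' : Fp L) • (1 : Matrix (Fin (n + n)) (Fin (n + n)) (AdeleRing (𝓞 (Fp L)) (Fp L)))) * Matrix.reindex ((e₂ (n := n)).sumCongr (e₂ (n := n))) ((e₂ (n := n)).sumCongr (e₂ (n := n))) (cayleyMoverMatrix (AdeleRing (𝓞 (Fp L)) (Fp L)) (Fin n)) * Matrix.fromBlocks (1 : Matrix (Fin (n + n)) (Fin (n + n)) (AdeleRing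 (𝓞 (Fp L)) (Fp L))) 0 0 (algebraMap (Fp L) (AdeleRing (𝓞 (Fp L)) (Fp L)) ((a'⁻¹ : (↥(maximalRealSubfield L))ˣ) : Fp L) • (1 : Matrix (Fin (n + n)) (Fin (n + n)) (AdeleRing (𝓞 (Fp L)) (Fp L))))) := by simp only [Matrix.mul_assoc]
      _ = _ := by
          rw [diag_eq_reindex L (algebraMap (Fp L) (AdeleRing (𝓞 (Fp L)) (Fp L)) (a' : Fp L)), diag_eq_reindex L (algebraMap (Fp L) (AdeleRing (𝓞 (Fp L)) (Fp L)) ((a'⁻¹ : (↥(maximalRealSubfield L))ˣ) : Fp L)), reindex_mul_reindex, reindex_mul_reindex, diag_mul_fromBlocks_mul_diag hcc', smul_zero,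
            ← diag_eq_reindex L (algebraMap (Fp L) (AdeleRing (𝓞 (Fp L)) (Fp L)) (a' : Fp L)), ← diag_eq_reindex L (algebraMap (Fp L) (AdeleRing (𝓞 (Fp L)) (Fp L)) ((a'⁻¹ : (↥(maximalRealSubfield L))ˣ) : Fp L))]
  rw [Submonoid.coe_mul, Submonoid.coe_mul, key, Matrix.mul_assoc, ← Submonoid.coe_mul, mul_inv_cancel, Submonoid.coe_one, Matrix.mul_one]

end Model

end Summit.HodgeConjecture.HodgeConjecture.Cruxes.HLiu418.K2LiuLinePairCayleySiegelModel

end
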